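import Summits.AtomisticToContinuum.HydrodynamicLimit.Theorems.TwoClocksEquilibriumFastWindowLDBirthT12Lorentz
import Summits.AtomisticToContinuum.HydrodynamicLimit.Theorems.TwoClocksEquilibriumFastWindowLDBirthT12ThalesCircle
import Summits.AtomisticToContinuum.HydrodynamicLimit.Theorems.TwoClocksEquilibriumFastWindowLDBirthT12Legendre
import HarnessLib

/-!
# The angular structure of the far-field (Lorentz) gain operator: own/partner exchange symmetry,
# the zonal form on the sphere, separable functions, and the one-step bound on the sector `ℓ ≥ 2`
# (helpers `t12_lorentzGain_separable`, `t12_lorentzGain_sector_le` of the line `birth`, crux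
# `TwoClocks.EquilibriumFastWindowLD`, stmt-AtomisticToContinuum-14440; FF2-infrastructure towards the
# registered analytic sub-goal `t12_logLinearPreimage_and_dipoleModulus`, plan §2 FACT F and §6)

The far-field (Lorentz-gas, partner at rest) gain operator of the linearised hard-sphere operator of
`ℝ³` (`lorentzGain`, file `…T12Lorentz`: `lorentzGain u v = ‖v‖(∫_{‖p‖<1} u(own Thales point) dp +
∫_{‖p‖<1} u(partner Thales point) dp)`, the `w = 0` specialisation of the exact Lambert-disc forms
`t12_gainFst_disc`, `t12_gainSnd_disc`) was known on RADIAL functions only (`lorentzGain_radial`: both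
radius ratios have the law `2ρ dρ`). This file determines its full ANGULAR structure.

* **Exchange symmetry** (`lintegral_ball_thalesFst_eq_thalesSnd`, `lintegral_hardSphereKernel_mul_comp_collide_fst_eq_snd`,
  `fluxMeasure_map_collide_fst_eq_snd`, `gainFst_eq_gainSnd`): for ALL `v, w ∈ ℝ³` the own outgoing
  velocity `v' = v - (u·ω)ω` and the partner outgoing velocity `w' = w + (u·ω)ω` (`u = v - w`) have THE
  SAME LAW under the flux measure `(u·ω)₊ dσ(ω)`:
  `∫_{S²} (u·ω)₊ ψ(v') dσ(ω) = ∫_{S²} (u·ω)₊ ψ(w') dσ(ω)` for every measurable `ψ` (no integrability).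
  Both run over the Thales sphere of `[w, v]`; in the Lambert disc the two parametrisations
  `w + ‖p‖² u ∓ ‖u‖√(1-‖p‖²) E p` and `w + (1-‖p‖²) u + ‖u‖√(1-‖p‖²) E p` differ by the azimuth flip
  `p ↦ -p` (`lintegral_ball_thalesFst_neg`, Lebesgue measure is even) and, in polar coordinates
  (`lintegral_ball_eq_lintegral_polar`), by the radial swap `ρ ↦ √(1-ρ²)`, which preserves `ρ dρ`
  (`lintegral_Ioo_mul_comp_sqrt_one_sub_sq`) — a `d = 3` phenomenon (the flux law of `c²` is uniform).
  Consequence for the plan: the gain term is TWICE its partner piece, `K₂ψ(v) = 2∫dM(w)∫(u·ω)₊ψ(w + (u·ω)ω)dσ`.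
* **Zonal form of the Lorentz operator** (`lorentzGain_eq_two_mul_integral`, `lorentzGain_smul`): for every
  measurable `u`, `lorentzGain u v = 2 ∫_{S²} ⟪v, ω⟫₊ u(⟪v, ω⟫ ω) dσ(ω)`, i.e. for unit `n`, `s ≥ 0`,
  `lorentzGain u (s n) = 2s ∫_{S²} ⟪n, ω⟫₊ u(s⟪n, ω⟫ ω) dσ(ω)` `= πs ∫₀¹ 4z (A_z u(sz ·))(n) dz` in the
  height/azimuth coordinates of the hat-box law (FACT F of the plan, §2, with its factor `4ρ`).
* **Separable functions** `u(r x) = a(r) Y(x)` (registered `t12_lorentzGain_separable`):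
  `lorentzGain u (s n) = 2s ∫_{S²} ⟪n, ω⟫₊ a(s⟪n, ω⟫) Y(ω) dσ(ω)` — a zonal kernel `2x₊ a(sx)` of the
  height `x = ⟪n, ω⟫` against the angular profile: direction-only data `2x₊` (`= πs · (2/π)x₊ / s`,
  `lorentzGain_smul_of_direction`), linear growth `2s x₊²` (`= πs · (2/π)x₊²`, the operator `T` of plan
  §3/§6; `lorentzGain_smul_of_linear`).
* **F2, one step on the sector `ℓ ≥ 2`** (registered `t12_lorentzGain_sector_le`; `abs_lorentzGain_le_of_sector`):
  `u(r x) = r Y(x)`, `|Y| ≤ m`, `∫ Y dσ = 0`, `∫ Y(ω) ω dσ = 0` ⟹ `|lorentzGain u v| ≤ π‖v‖² m`, from the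
  zonal form, the angular contraction lemma `t12_angularContraction` (`…T12Angular`) and the certificate
  `∫_{-1}^{1}|x₊² - 1/8 - x/4| dx = 1/4` (`…T12Legendre`): `2 · 2π · 1/4 = π`, versus `(4/3)π` on the positive
  cone (`t12_lorentzGain_abs_le`) — after division by `ν ≈ π‖v‖` and the weight `‖v‖` the marginal
  one-step constant `1` of plan §6, whence the iteration (FF2/FF4).

NOT here: the circle-average (`A_ρ`) bookkeeping as a definition, the composition of two steps (FF2), the
comparison with the thermal partner `w ∼ M` (FF1). All statements are [folklore] (geometry of one
hard-sphere collision, Cercignani–Illner–Pulvirenti 1994 §3.1; far-field limit, Grad 1963 §4).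
-/

noncomputable section

open MeasureTheory Real Set Filter Metric
open scoped ENNReal BigOperators InnerProductSpace
namespace Summit.AtomisticToContinuum.HydrodynamicLimit.Theorems.ClampedCorrectorBirth

open Literature.Analysis.FluidPDE Literature.MathematicalPhysics.KineticTheory Literature.Analysis.Calculus

variable {v w : EuclideanSpace ℝ (Fin 3)}

/-! ### One-dimensional and planar preliminaries -/

/-- The radial swap `ρ ↦ √(1 - ρ²)` preserves the measure `ρ dρ` on `(0, 1)`:
`∫₀¹ c G(√(1 - c²)) dc = ∫₀¹ ρ G(ρ) dρ` for every `G ≥ 0` (`lintegral_Ioo_two_mul_comp_sqrt_one_sub_sq`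
without the factor `2`). [folklore] -/
theorem lintegral_Ioo_mul_comp_sqrt_one_sub_sq (G : ℝ → ℝ≥0∞) :
    ∫⁻ c in Ioo (0:ℝ) 1, ENNReal.ofReal c * G (√(1 - c ^ 2)) = ∫⁻ ρ in Ioo (0:ℝ) 1, ENNReal.ofReal ρ * G ρ := by
  have h2 : ∀ f : ℝ → ℝ≥0∞, ∫⁻ c in Ioo (0:ℝ) 1, ENNReal.ofReal (2 * c) * f c =
      2 * ∫⁻ c in Ioo (0:ℝ) 1, ENNReal.ofReal c * f c := fun f => by
    rw [← lintegral_const_mul' _ _ ENNReal.ofNat_ne_top]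
    refine lintegral_congr fun c => ?_
    rw [ENNReal.ofReal_mul zero_le_two, ENNReal.ofReal_ofNat, mul_assoc]
  have key := lintegral_Ioo_two_mul_comp_sqrt_one_sub_sq G
  rw [h2 (fun c => G (√(1 - c ^ 2))), h2 G] at key
  exact (ENNReal.mul_right_inj two_ne_zero ENNReal.ofNat_ne_top).1 key

/-- **The azimuth flip on the Lambert disc**: `p ↦ -p` preserves Lebesgue measure on the unit disc, so
the sign of the tangential component of the own Thales parametrisation may be flipped:
`∫_{‖p‖<1} F(w + ‖p‖² u - ‖u‖√(1-‖p‖²) E p) dp = ∫_{‖p‖<1} F(w + ‖p‖² u + ‖u‖√(1-‖p‖²) E p) dp`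
(`E = Lambert.embed û` linear). [folklore] -/
theorem lintegral_ball_thalesFst_neg (v w : EuclideanSpace ℝ (Fin 3)) (F : EuclideanSpace ℝ (Fin 3) → ℝ≥0∞) :
    ∫⁻ p in ball (0 : EuclideanSpace ℝ (Fin 2)) 1,
        F (w + (‖p‖ ^ 2) • (v - w) - (‖v - w‖ * √(1 - ‖p‖ ^ 2)) • Lambert.embed (‖v - w‖⁻¹ • (v - w)) p) =
      ∫⁻ p in ball (0 : EuclideanSpace ℝ (Fin 2)) 1,
        F (w + (‖p‖ ^ 2) • (v - w) + (‖v - w‖ * √(1 - ‖p‖ ^ 2)) • Lambert.embed (‖v - w‖⁻¹ • (v - w)) p) := by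
  rw [← lintegral_indicator measurableSet_ball, ← lintegral_indicator measurableSet_ball,
    ← lintegral_neg_eq_self (μ := (volume : Measure (EuclideanSpace ℝ (Fin 2))))
      ((ball (0 : EuclideanSpace ℝ (Fin 2)) 1).indicator fun p =>
        F (w + (‖p‖ ^ 2) • (v - w) + (‖v - w‖ * √(1 - ‖p‖ ^ 2)) • Lambert.embed (‖v - w‖⁻¹ • (v - w)) p))]
  refine lintegral_congr fun p => ?_
  by_cases hp : p ∈ ball (0 : EuclideanSpace ℝ (Fin 2)) 1
  · have hnp : -p ∈ ball (0 : EuclideanSpace ℝ (Fin 2)) 1 := by rwa [mem_ball_zero_iff, norm_neg, ← mem_ball_zero_iff]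
    rw [indicator_of_mem hp, indicator_of_mem hnp, norm_neg, Lambert.embed_neg, smul_neg, ← sub_eq_add_neg]
  · have hnp : -p ∉ ball (0 : EuclideanSpace ℝ (Fin 2)) 1 := fun h => hp (by
      rwa [mem_ball_zero_iff, norm_neg, ← mem_ball_zero_iff] at h)
    rw [indicator_of_notMem hp, indicator_of_notMem hnp]

/-! ### The own/partner exchange symmetry of one hard-sphere collision (`d = 3`) -/

/-- **The two Thales parametrisations have the same law** (core of the exchange symmetry): for all
`v, w ∈ ℝ³` and measurable `F ≥ 0`,
`∫_{‖p‖<1} F(w + ‖p‖² u - ‖u‖√(1-‖p‖²) E p) dp = ∫_{‖p‖<1} F(w + (1-‖p‖²) u + ‖u‖√(1-‖p‖²) E p) dp`.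
In polar coordinates `p = ρ(cos φ, sin φ)` both sides are `∫₀¹ ρ ∫ F(w + r² u + ‖u‖ r √(1-r²)(cos φ e₁ + sin φ e₂)) dφ dρ`
with `r = ρ` resp. `r = √(1-ρ²)`, and the radial swap preserves `ρ dρ` (after the azimuth flip
`lintegral_ball_thalesFst_neg`). This is special to `d = 3` (the flux law of `c²` is uniform). [folklore] -/
theorem lintegral_ball_thalesFst_eq_thalesSnd (v w : EuclideanSpace ℝ (Fin 3)) {F : EuclideanSpace ℝ (Fin 3) → ℝ≥0∞}
    (hF : Measurable F) :
    ∫⁻ p in ball (0 : EuclideanSpace ℝ (Fin 2)) 1,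
        F (w + (‖p‖ ^ 2) • (v - w) - (‖v - w‖ * √(1 - ‖p‖ ^ 2)) • Lambert.embed (‖v - w‖⁻¹ • (v - w)) p) =
      ∫⁻ p in ball (0 : EuclideanSpace ℝ (Fin 2)) 1,
        F (w + (1 - ‖p‖ ^ 2) • (v - w) + (‖v - w‖ * √(1 - ‖p‖ ^ 2)) • Lambert.embed (‖v - w‖⁻¹ • (v - w)) p) := by
  rw [lintegral_ball_thalesFst_neg v w F]
  have hG1 : Measurable fun p : EuclideanSpace ℝ (Fin 2) =>
      F (w + (‖p‖ ^ 2) • (v - w) + (‖v - w‖ * √(1 - ‖p‖ ^ 2)) • Lambert.embed (‖v - w‖⁻¹ • (v - w)) p) := by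
    refine hF.comp ?_
    unfold Lambert.embed; fun_prop
  have hG2 : Measurable fun p : EuclideanSpace ℝ (Fin 2) =>
      F (w + (1 - ‖p‖ ^ 2) • (v - w) + (‖v - w‖ * √(1 - ‖p‖ ^ 2)) • Lambert.embed (‖v - w‖⁻¹ • (v - w)) p) := by
    refine hF.comp ?_
    unfold Lambert.embed; fun_prop
  rw [lintegral_ball_eq_lintegral_polar hG1, lintegral_ball_eq_lintegral_polar hG2]
  -- the common circle integral `g r`
  have key := lintegral_Ioo_mul_comp_sqrt_one_sub_sq fun r => ∫⁻ φ in Ioo (-π) π,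
    F (w + (r ^ 2) • (v - w) + (‖v - w‖ * r * √(1 - r ^ 2)) •
      (cos φ • Lambert.e₁ (‖v - w‖⁻¹ • (v - w)) + sin φ • Lambert.e₂ (‖v - w‖⁻¹ • (v - w))))
  calc ∫⁻ ρ in Ioo (0:ℝ) 1, ENNReal.ofReal ρ * ∫⁻ φ in Ioo (-π) π,
          F (w + (‖(WithLp.toLp 2 ![ρ * cos φ, ρ * sin φ] : EuclideanSpace ℝ (Fin 2))‖ ^ 2) • (v - w) +
            (‖v - w‖ * √(1 - ‖(WithLp.toLp 2 ![ρ * cos φ, ρ * sin φ] : EuclideanSpace ℝ (Fin 2))‖ ^ 2)) •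
              Lambert.embed (‖v - w‖⁻¹ • (v - w)) (WithLp.toLp 2 ![ρ * cos φ, ρ * sin φ]))
      = ∫⁻ ρ in Ioo (0:ℝ) 1, ENNReal.ofReal ρ * ∫⁻ φ in Ioo (-π) π,
          F (w + (ρ ^ 2) • (v - w) + (‖v - w‖ * ρ * √(1 - ρ ^ 2)) •
            (cos φ • Lambert.e₁ (‖v - w‖⁻¹ • (v - w)) + sin φ • Lambert.e₂ (‖v - w‖⁻¹ • (v - w)))) := by
        refine setLIntegral_congr_fun measurableSet_Ioo fun ρ hρ => ?_
        congr 1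
        refine lintegral_congr fun φ => ?_
        rw [norm_toLp_polar hρ.1.le, embed_toLp_vec_polar, smul_smul, mul_right_comm]
    _ = ∫⁻ ρ in Ioo (0:ℝ) 1, ENNReal.ofReal ρ * ∫⁻ φ in Ioo (-π) π,
          F (w + (√(1 - ρ ^ 2) ^ 2) • (v - w) + (‖v - w‖ * √(1 - ρ ^ 2) * √(1 - √(1 - ρ ^ 2) ^ 2)) •
            (cos φ • Lambert.e₁ (‖v - w‖⁻¹ • (v - w)) + sin φ • Lambert.e₂ (‖v - w‖⁻¹ • (v - w)))) := key.symm
    _ = _ := by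
        refine setLIntegral_congr_fun measurableSet_Ioo fun ρ hρ => ?_
        have hσ : √(1 - ρ ^ 2) ^ 2 = 1 - ρ ^ 2 := sq_sqrt (by nlinarith [hρ.1, hρ.2])
        have hτ : √(1 - (1 - ρ ^ 2)) = ρ := by rw [sub_sub_cancel, sqrt_sq hρ.1.le]
        rw [hσ, hτ]
        congr 1
        refine lintegral_congr fun φ => ?_
        rw [norm_toLp_polar hρ.1.le, embed_toLp_vec_polar, smul_smul]

/-- **Exchange symmetry of the gain term, `lintegral` form.** For all `v, w ∈ ℝ³` and measurable
`F ≥ 0` on `ℝ³`: `∫_{S²} (u·ω)₊ F(v') dσ(ω) = ∫_{S²} (u·ω)₊ F(w') dσ(ω)`, `(v', w') = collide ω (v, w)` —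
under the flux measure the own outgoing velocity `v' = v - (u·ω)ω` and the partner outgoing velocity
`w' = w + (u·ω)ω` HAVE THE SAME LAW (both live on the Thales sphere of `[w, v]`, radius ratio `2ρ dρ`,
direction cosine `=` radius ratio, uniform azimuth). [folklore] -/
theorem lintegral_hardSphereKernel_mul_comp_collide_fst_eq_snd (v w : EuclideanSpace ℝ (Fin 3))
    {F : EuclideanSpace ℝ (Fin 3) → ℝ≥0∞} (hF : Measurable F) :
    ∫⁻ ω, ENNReal.ofReal (hardSphereKernel (v, w) ω) * F (collide ω (v, w)).1 ∂sphereMeasure =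
      ∫⁻ ω, ENNReal.ofReal (hardSphereKernel (v, w) ω) * F (collide ω (v, w)).2 ∂sphereMeasure := by
  rw [lintegral_hardSphereKernel_mul_comp_collide_fst v w hF, lintegral_hardSphereKernel_mul_comp_collide_snd v w hF,
    lintegral_ball_thalesFst_eq_thalesSnd v w hF]

/-- The flux-weighted law of the own outgoing velocity is ALSO the partner's lifted disc law. [folklore] -/
theorem fluxMeasure_map_collide_fst_eq_map_thalesSnd (v w : EuclideanSpace ℝ (Fin 3)) :
    (sphereMeasure.withDensity fun ω => ENNReal.ofReal (hardSphereKernel (v, w) ω)).map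
        (fun ω => (collide ω (v, w)).1) =
      (ENNReal.ofReal ‖v - w‖ • volume.restrict (ball (0 : EuclideanSpace ℝ (Fin 2)) 1)).map
        (fun p => w + (1 - ‖p‖ ^ 2) • (v - w) +
          (‖v - w‖ * √(1 - ‖p‖ ^ 2)) • Lambert.embed (‖v - w‖⁻¹ • (v - w)) p) :=
  map_fluxMeasure_eq_map_ball_of_lintegral (by unfold collide; fun_prop)
    (by unfold Lambert.embed; fun_prop) fun _ hF => by
      rw [lintegral_hardSphereKernel_mul_comp_collide_fst_eq_snd v w hF,
        lintegral_hardSphereKernel_mul_comp_collide_snd v w hF]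

/-- **Exchange symmetry as an identity of measures**: the images of the flux measure `(u·ω)₊ dσ(ω)`
under `ω ↦ v'` and under `ω ↦ w'` coincide. [folklore] -/
theorem fluxMeasure_map_collide_fst_eq_snd (v w : EuclideanSpace ℝ (Fin 3)) :
    (sphereMeasure.withDensity fun ω => ENNReal.ofReal (hardSphereKernel (v, w) ω)).map
        (fun ω => (collide ω (v, w)).1) =
      (sphereMeasure.withDensity fun ω => ENNReal.ofReal (hardSphereKernel (v, w) ω)).map
        (fun ω => (collide ω (v, w)).2) := by
  rw [fluxMeasure_map_collide_fst_eq_map_thalesSnd, fluxMeasure_map_collide_snd]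

/-- **Exchange symmetry of the gain term, Bochner form**: for all `v, w ∈ ℝ³` and EVERY measurable
`ψ : ℝ³ → ℝ` (no integrability needed), `∫_{S²} (u·ω)₊ ψ(v') dσ(ω) = ∫_{S²} (u·ω)₊ ψ(w') dσ(ω)`. Hence
the gain term of the linearised hard-sphere operator is TWICE its partner piece,
`(K₂ψ)(v) = 2 ∫ dM(w) ∫ (u·ω)₊ ψ(w + (u·ω)ω) dσ(ω)`. [folklore] -/
theorem gainFst_eq_gainSnd (v w : EuclideanSpace ℝ (Fin 3)) {ψ : EuclideanSpace ℝ (Fin 3) → ℝ}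
    (hψ : Measurable ψ) :
    ∫ ω, hardSphereKernel (v, w) ω * ψ (collide ω (v, w)).1 ∂sphereMeasure =
      ∫ ω, hardSphereKernel (v, w) ω * ψ (collide ω (v, w)).2 ∂sphereMeasure := by
  rw [integral_hardSphereKernel_mul_comp_of_map_eq_map (by unfold collide; fun_prop)
    (by unfold Lambert.embed; fun_prop) (norm_nonneg _) (fluxMeasure_map_collide_fst_eq_map_thalesSnd v w) hψ,
    t12_gainSnd_disc v w ψ hψ]

/-! ### The zonal form of the far-field gain operator -/

variable {u : EuclideanSpace ℝ (Fin 3) → ℝ}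

/-- **The far-field gain is twice its partner piece**: `lorentzGain u v = 2 ∫_{S²} (v·ω)₊ u(w') dσ(ω)` at
partner rest, for every measurable `u`. [folklore] -/
theorem lorentzGain_eq_two_mul_gainSnd (v : EuclideanSpace ℝ (Fin 3)) (hu : Measurable u) :
    lorentzGain u v = 2 * ∫ ω, hardSphereKernel (v, 0) ω * u (collide ω (v, 0)).2 ∂sphereMeasure := by
  rw [← gain_zero_eq_lorentzGain v hu, gainFst_eq_gainSnd v 0 hu, two_mul]

/-- **The zonal form of the far-field gain operator**: for every measurable `u : ℝ³ → ℝ` and every `v`,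
`lorentzGain u v = 2 ∫_{S²} ⟪v, ω⟫₊ u(⟪v, ω⟫ ω) dσ(ω)` — an average of `u` over the Thales sphere of
`[0, v]` parametrised by the direction `ω` of its points, weight `2⟪v, ω⟫₊ dσ(ω)`. [folklore] -/
theorem lorentzGain_eq_two_mul_integral (v : EuclideanSpace ℝ (Fin 3)) (hu : Measurable u) :
    lorentzGain u v = 2 * ∫ ω : sphere (0 : EuclideanSpace ℝ (Fin 3)) 1,
      max ⟪v, (ω : EuclideanSpace ℝ (Fin 3))⟫_ℝ 0 *
        u (⟪v, (ω : EuclideanSpace ℝ (Fin 3))⟫_ℝ • (ω : EuclideanSpace ℝ (Fin 3))) ∂sphereMeasure := by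
  rw [lorentzGain_eq_two_mul_gainSnd v hu]
  simp [hardSphereKernel, collide]

/-- **The zonal form in polar variables**: for unit `n`, `0 ≤ s` and measurable `u`,
`lorentzGain u (s n) = 2s ∫_{S²} ⟪n, ω⟫₊ u(s⟪n, ω⟫ ω) dσ(ω)`; by the hat-box law in the coordinates
`(z, φ) = (height, azimuth)` this is `πs ∫₀¹ 4z (A_z u(sz ·))(n) dz` with the circle averages `A_z` of
FACT F. [folklore] -/
theorem lorentzGain_smul {n : EuclideanSpace ℝ (Fin 3)} {s : ℝ} (hs : 0 ≤ s) (hu : Measurable u) :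
    lorentzGain u (s • n) = 2 * s * ∫ ω : sphere (0 : EuclideanSpace ℝ (Fin 3)) 1,
      max ⟪n, (ω : EuclideanSpace ℝ (Fin 3))⟫_ℝ 0 *
        u ((s * ⟪n, (ω : EuclideanSpace ℝ (Fin 3))⟫_ℝ) • (ω : EuclideanSpace ℝ (Fin 3))) ∂sphereMeasure := by
  rw [lorentzGain_eq_two_mul_integral _ hu, mul_assoc]
  congr 1
  rw [← integral_const_mul]
  refine integral_congr_ae (Eventually.of_forall fun ω => ?_)
  dsimp only
  rw [real_inner_smul_left, ← mul_assoc]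
  congr 1
  rw [mul_max_of_nonneg _ _ hs, mul_zero]

/-- **The far-field gain on separable functions** `u(r x) = a(r) Y(x)` (`r > 0`, `‖x‖ = 1`): for unit `n`
and `0 ≤ s`, `lorentzGain u (s n) = 2s ∫_{S²} ⟪n, ω⟫₊ a(s⟪n, ω⟫) Y(ω) dσ(ω)` — a ZONAL kernel
`2 x₊ a(s x)` (`x = ⟪n, ω⟫`) against the angular profile `Y`; `= πs ∫₀¹ 4ρ a(ρs) (A_ρ Y)(n) dρ` in the
circle-average notation of FACT F. [folklore] -/
theorem lorentzGain_smul_of_separable {n : EuclideanSpace ℝ (Fin 3)} {s : ℝ} (hs : 0 ≤ s) (hu : Measurable u)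
    {a : ℝ → ℝ} {Y : EuclideanSpace ℝ (Fin 3) → ℝ}
    (hsep : ∀ (r : ℝ) (x : EuclideanSpace ℝ (Fin 3)), 0 < r → ‖x‖ = 1 → u (r • x) = a r * Y x) :
    lorentzGain u (s • n) = 2 * s * ∫ ω : sphere (0 : EuclideanSpace ℝ (Fin 3)) 1,
      max ⟪n, (ω : EuclideanSpace ℝ (Fin 3))⟫_ℝ 0 * a (s * ⟪n, (ω : EuclideanSpace ℝ (Fin 3))⟫_ℝ) *
        Y ω ∂sphereMeasure := by
  rcases hs.eq_or_lt with rfl | hs'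
  · rw [zero_smul, lorentzGain_zero_right, mul_zero, zero_mul]
  rw [lorentzGain_smul hs hu]
  congr 1
  refine integral_congr_ae (Eventually.of_forall fun ω => ?_)
  dsimp only
  rcases le_or_gt ⟪n, (ω : EuclideanSpace ℝ (Fin 3))⟫_ℝ 0 with hz | hz
  · rw [max_eq_right hz, zero_mul, zero_mul, zero_mul]
  · rw [hsep _ _ (mul_pos hs' hz) (by simp), mul_assoc]

/-- **Direction-only data** `u(r x) = Y(x)`: `lorentzGain u (s n) = 2s ∫_{S²} ⟪n, ω⟫₊ Y(ω) dσ(ω)` — zonal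
kernel `2x₊ = πs · (2/π) x₊ / s`, mass `2s · π = 2πs = lorentzGain 1` (`λ₀(0) = 2`). [folklore] -/
theorem lorentzGain_smul_of_direction {n : EuclideanSpace ℝ (Fin 3)} {s : ℝ} (hs : 0 ≤ s) (hu : Measurable u)
    {Y : EuclideanSpace ℝ (Fin 3) → ℝ}
    (hsep : ∀ (r : ℝ) (x : EuclideanSpace ℝ (Fin 3)), 0 < r → ‖x‖ = 1 → u (r • x) = Y x) :
    lorentzGain u (s • n) = 2 * s * ∫ ω : sphere (0 : EuclideanSpace ℝ (Fin 3)) 1,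
      max ⟪n, (ω : EuclideanSpace ℝ (Fin 3))⟫_ℝ 0 * Y ω ∂sphereMeasure := by
  rw [lorentzGain_smul_of_separable hs hu (a := fun _ => (1:ℝ)) (fun r x hr hx => by rw [hsep r x hr hx, one_mul])]
  simp_rw [mul_one]

/-- **Linear-growth data** `u(r x) = r Y(x)`: `lorentzGain u (s n) = 2s² ∫_{S²} ⟪n, ω⟫₊² Y(ω) dσ(ω)` — the
zonal kernel `2x₊² = πs · (2/π) x₊²` of the one-step operator `T` of plan §3/§6 on the linear-growth
class (mass `2s² · 2π/3 = (4/3)πs² = lorentzGain ‖·‖`, `λ₀(1) = 4/3`). [folklore] -/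
theorem lorentzGain_smul_of_linear {n : EuclideanSpace ℝ (Fin 3)} {s : ℝ} (hs : 0 ≤ s) (hu : Measurable u)
    {Y : EuclideanSpace ℝ (Fin 3) → ℝ}
    (hsep : ∀ (r : ℝ) (x : EuclideanSpace ℝ (Fin 3)), 0 < r → ‖x‖ = 1 → u (r • x) = r * Y x) :
    lorentzGain u (s • n) = 2 * s ^ 2 * ∫ ω : sphere (0 : EuclideanSpace ℝ (Fin 3)) 1,
      max ⟪n, (ω : EuclideanSpace ℝ (Fin 3))⟫_ℝ 0 ^ 2 * Y ω ∂sphereMeasure := by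
  rw [lorentzGain_smul_of_separable hs hu (a := fun r => r) hsep, show 2 * s ^ 2 = 2 * s * s by ring,
    mul_assoc (2 * s) s]
  congr 1
  rw [← integral_const_mul]
  refine integral_congr_ae (Eventually.of_forall fun ω => ?_)
  dsimp only
  rcases le_or_gt ⟪n, (ω : EuclideanSpace ℝ (Fin 3))⟫_ℝ 0 with hz | hz
  · rw [max_eq_right hz]; ring
  · rw [max_eq_left hz.le]; ring

/-! ### The one-step bound on the sector `ℓ ≥ 2` -/

/-- **One far-field step on the sector `ℓ ≥ 2` of the linear-growth class**: if `u(r x) = r Y(x)` with `Y`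
measurable, `|Y| ≤ m` on `S²`, zero zonal average `∫_{S²} Y dσ = 0` and zero dipole moment
`∫_{S²} Y(ω) ω dσ(ω) = 0`, then for unit `n` and `0 ≤ s`: `|lorentzGain u (s n)| ≤ π s² m` — versus
`(4/3)π s² m` without the cancellations (`t12_lorentzGain_abs_le`). Proof: the zonal form with kernel
`2x₊²`, the angular contraction lemma `t12_angularContraction` at the optimal affine profile `1/8 + x/4`,
and the certificate `∫_{-1}^{1} |x₊² - 1/8 - x/4| dx = 1/4` (`t12_posPartSq_affineL1`):
`2s² · m · 2π · (1/4) = π s² m` (the marginal constant `1` of plan §6 after division by `ν ≈ πs` and the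
weight `s`). [folklore] -/
theorem abs_lorentzGain_smul_le_of_sector {n : EuclideanSpace ℝ (Fin 3)} (hn : ‖n‖ = 1) {s : ℝ} (hs : 0 ≤ s)
    (hu : Measurable u) {Y : EuclideanSpace ℝ (Fin 3) → ℝ} (hY : Measurable Y) {m : ℝ}
    (hsep : ∀ (r : ℝ) (x : EuclideanSpace ℝ (Fin 3)), 0 < r → ‖x‖ = 1 → u (r • x) = r * Y x)
    (hm : ∀ x : EuclideanSpace ℝ (Fin 3), ‖x‖ = 1 → |Y x| ≤ m)
    (h0 : ∫ ω : sphere (0 : EuclideanSpace ℝ (Fin 3)) 1, Y ω ∂sphereMeasure = 0)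
    (h1 : ∫ ω : sphere (0 : EuclideanSpace ℝ (Fin 3)) 1, Y ω • (ω : EuclideanSpace ℝ (Fin 3)) ∂sphereMeasure = 0) :
    |lorentzGain u (s • n)| ≤ π * s ^ 2 * m := by
  rw [lorentzGain_smul_of_linear hs hu hsep, abs_mul, abs_of_nonneg (by positivity)]
  have hk : IntervalIntegrable (fun x : ℝ => max x 0 ^ 2) volume (-1) 1 :=
    (by fun_prop : Continuous fun x : ℝ => max x 0 ^ 2).intervalIntegrable _ _
  have key := t12_angularContraction n hn (fun x => max x 0 ^ 2) (1 / 8) (1 / 4) hk (fun ω => Y ω) m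
    (hY.comp continuous_subtype_val.measurable).aestronglyMeasurable (fun ω => hm _ (by simp)) h0 h1
  have hI : ∫ x in (-1:ℝ)..1, |max x 0 ^ 2 - 1 / 8 - 1 / 4 * x| = 1 / 4 := by
    refine Eq.trans (intervalIntegral.integral_congr fun x _ => ?_) t12_posPartSq_affineL1
    congr 1; ring
  rw [hI] at key
  calc 2 * s ^ 2 * |∫ ω : sphere (0 : EuclideanSpace ℝ (Fin 3)) 1,
        max ⟪n, (ω : EuclideanSpace ℝ (Fin 3))⟫_ℝ 0 ^ 2 * Y ω ∂sphereMeasure|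
      ≤ 2 * s ^ 2 * (m * (2 * π * (1 / 4))) := by gcongr
    _ = π * s ^ 2 * m := by ring

/-- **The sector bound at a general velocity**: `|lorentzGain u v| ≤ π ‖v‖² m` under the hypotheses of
`abs_lorentzGain_smul_le_of_sector`. [folklore] -/
theorem abs_lorentzGain_le_of_sector (v : EuclideanSpace ℝ (Fin 3)) (hu : Measurable u)
    {Y : EuclideanSpace ℝ (Fin 3) → ℝ} (hY : Measurable Y) {m : ℝ}
    (hsep : ∀ (r : ℝ) (x : EuclideanSpace ℝ (Fin 3)), 0 < r → ‖x‖ = 1 → u (r • x) = r * Y x)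
    (hm : ∀ x : EuclideanSpace ℝ (Fin 3), ‖x‖ = 1 → |Y x| ≤ m)
    (h0 : ∫ ω : sphere (0 : EuclideanSpace ℝ (Fin 3)) 1, Y ω ∂sphereMeasure = 0)
    (h1 : ∫ ω : sphere (0 : EuclideanSpace ℝ (Fin 3)) 1, Y ω • (ω : EuclideanSpace ℝ (Fin 3)) ∂sphereMeasure = 0) :
    |lorentzGain u v| ≤ π * ‖v‖ ^ 2 * m := by
  rcases eq_or_ne v 0 with rfl | hv
  · have h := hm _ (show ‖EuclideanSpace.single (0 : Fin 3) (1:ℝ)‖ = 1 by simp)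
    simp only [lorentzGain_zero_right, abs_zero, norm_zero]
    nlinarith [abs_nonneg (Y (EuclideanSpace.single (0 : Fin 3) (1:ℝ))), pi_pos]
  have hn : ‖‖v‖⁻¹ • v‖ = 1 := norm_smul_inv_norm hv
  have hv' : v = ‖v‖ • (‖v‖⁻¹ • v) := by rw [smul_smul, mul_inv_cancel₀ (norm_ne_zero_iff.2 hv), one_smul]
  conv_lhs => rw [hv']
  exact abs_lorentzGain_smul_le_of_sector hn (norm_nonneg v) hu hY hsep hm h0 h1

/-! ### Registered helpers -/

/-- **Registered helper `t12_lorentzGain_separable` (F1) — the zonal-kernel form of the far-field gain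
operator on separable functions.** For `n ∈ ℝ³`, `0 ≤ s`, and `u : ℝ³ → ℝ` measurable and SEPARABLE on
rays, `u(r x) = a(r) Y(x)` for `r > 0`, `‖x‖ = 1` (`a : ℝ → ℝ` radial profile, `Y : ℝ³ → ℝ` angular
profile, read on unit vectors):
`lorentzGain u (s n) = 2s ∫_{S²} ⟪n, ω⟫₊ a(s⟪n, ω⟫) Y(ω) dσ(ω)`.
For unit `n` this is a ZONAL kernel `k_s(x) = 2 x₊ a(s x)` of the height `x = ⟪n, ω⟫` acting on `Y`
(by the hat-box law `t12_sphereMeasure_map_inner`, `= πs ∫₀¹ 4ρ a(ρs) (A_ρ Y)(n) dρ` with the circle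
averages `A_ρ` of FACT F): direction-only data (`a ≡ 1`) have the kernel `2x₊ = πs·(2/π)x₊/s`
(`lorentzGain_smul_of_direction`), linear growth (`a = id`) the kernel `2s x₊²` (`lorentzGain_smul_of_linear`),
and `Y ≡ 1` recovers `lorentzGain_radial`. Behind it: the exchange symmetry `gainFst_eq_gainSnd` (own and
partner outgoing velocities have the same flux-law, every `v, w`) and the zonal form
`lorentzGain u v = 2 ∫_{S²} ⟪v, ω⟫₊ u(⟪v, ω⟫ω) dσ(ω)` (`lorentzGain_eq_two_mul_integral`). [folklore] -/
theorem t12_lorentzGain_separable : ∀ (n : EuclideanSpace ℝ (Fin 3)) (s : ℝ), 0 ≤ s → ∀ (u : EuclideanSpace ℝ (Fin 3) → ℝ) (a : ℝ → ℝ) (Y : EuclideanSpace ℝ (Fin 3) → ℝ), Measurable u → (∀ (r : ℝ) (x : EuclideanSpace ℝ (Fin 3)), 0 < r → ‖x‖ = 1 → u (r • x) = a r * Y x) → Summit.AtomisticToContinuum.HydrodynamicLimit.Theorems.ClampedCorrectorBirth.lorentzGain u (s • n) = 2 * s * ∫ ω : Metric.sphere (0 : EuclideanSpace ℝ (Fin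 3)) 1, max (inner ℝ n (ω : EuclideanSpace ℝ (Fin 3))) 0 * a (s * inner ℝ n (ω : EuclideanSpace ℝ (Fin 3))) * Y (ω : EuclideanSpace ℝ (Fin 3)) ∂Literature.MathematicalPhysics.KineticTheory.sphereMeasure :=
  fun _ _ hs _ _ _ hu hsep => lorentzGain_smul_of_separable hs hu hsep

/-- **Registered helper `t12_lorentzGain_sector_le` (F2) — one far-field step on the sector `ℓ ≥ 2` of
the linear-growth class.** For `u : ℝ³ → ℝ` measurable with `u(r x) = r Y(x)` (`r > 0`, `‖x‖ = 1`), `Y`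
measurable, `|Y| ≤ m` on the unit sphere, ZERO ZONAL AVERAGE `∫_{S²} Y dσ = 0` and ZERO DIPOLE MOMENT
`∫_{S²} Y(ω) ω dσ(ω) = 0`: for every `v ∈ ℝ³`, `|lorentzGain u v| ≤ π ‖v‖² m`.
(Zonal form with kernel `2x₊²`, the angular contraction lemma `t12_angularContraction` at the optimal affine
profile `1/8 + x/4`, and the `L¹` certificate `t12_posPartSq_affineL1`: `2‖v‖² · m · 2π · 1/4`.) Dividing by
the collision frequency `ν(v) ≥ π‖v‖` and the weight `‖v‖`: the one-step far-field operator `ν⁻¹K₂^∞` has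
norm `≤ 1` on the `ℓ ≥ 2` functions of linear growth with separated variables — the marginal constant `1`
of plan §6 ("THE NUMBERS"), versus `4/3` on the positive cone (`t12_lorentzGain_abs_le`). [folklore] -/
theorem t12_lorentzGain_sector_le : ∀ (u Y : EuclideanSpace ℝ (Fin 3) → ℝ) (m : ℝ), Measurable u → Measurable Y → (∀ (r : ℝ) (x : EuclideanSpace ℝ (Fin 3)), 0 < r → ‖x‖ = 1 → u (r • x) = r * Y x) → (∀ x : EuclideanSpace ℝ (Fin 3), ‖x‖ = 1 → |Y x| ≤ m) → ∫ ω : Metric.sphere (0 : EuclideanSpace ℝ (Fin 3)) 1, Y (ω : EuclideanSpace ℝ (Fin 3)) ∂Literature.MathematicalPhysics.KineticTheory.sphereMeasure = 0 → ∫ ω : Metric.sphere (0 : EuclideanSpace ℝ (Fin 3)) 1, Y (ω : EuclideanSpace ℝ (Fin 3)) • (ω : EuclideanSpace ℝ (Fin 3)) ∂Literature.MathematicalPhysics.KineticTheory.sphereMeasure = 0 → ∀ v : EuclideanSpace ℝ (Fin 3), |Summit.AtomisticToContinuum.HydrodynamicLimit.Theorems.ClampedCorrectorBirth.lorentzGain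 u v| ≤ Real.pi * ‖v‖ ^ 2 * m :=
  fun _ _ _ hu hY hsep hm h0 h1 v => abs_lorentzGain_le_of_sector v hu hY hsep hm h0 h1

end Summit.AtomisticToContinuum.HydrodynamicLimit.Theorems.ClampedCorrectorBirth

end
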